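import Summits.AtomisticToContinuum.HydrodynamicLimit.Theorems.RelayRaceLocalityLightConeInLawSketchLine
import Summits.AtomisticToContinuum.HydrodynamicLimit.Theorems.ImplosionDichotomyHydroLimitInBandEquilibrium
import Literature.MathematicalPhysics.KineticTheory.HardSphereEulerProofs

/-!
# Stub `stub_timeZero` of the line `Sketch` for the crux `LightConeInLaw`
(stmt-AtomisticToContinuum-12500; route `RelayRaceLocality`, sub-problem `HydrodynamicLimit`)

The slice `t = 0` of the two-copy light cone in law: two hard-sphere gases (arbitrary particle
numbers `n₁ N`, `n₂ N`, arbitrary probability laws `P₁ N`, `P₂ N`, arbitrary flows) whose time-`0`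
empirical fields satisfy laws of large numbers (`LLNAt … 0`) towards data `(ρ₁, U₁, Θ₁)`,
`(ρ₂, U₂, Θ₂)` agreeing in reduced units (`ρσ³`, `U`, `Θ`) on the ball `B(x₀, R)` have
asymptotically equal expectations of every bounded `1`-Lipschitz functional `F` of the reduced
empirical fields tested against a continuous `χ` vanishing off `B(x₀, R)`.

Proof (elementary): (i) the two deterministic limits
`L = (σ³ ∫χρ, σ³ • ∫(χρ)•U, σ³ ∫χE(ρ,U,Θ))` coincide, because pointwise either `χ x = 0` or the
reduced data agree; (ii) for each gas the reduced triple converges to `L` in probability (sup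
distance on `ℝ × V3 × ℝ`, union bound, `LLNAt` at level `δ/σ³`); (iii) bounded-Lipschitz merging:
`|∫ F(X_N) dP − F L| ≤ δ + 2 P{δ < dist(X_N, L)}`.
-/

namespace Summit.AtomisticToContinuum.HydrodynamicLimit.Theorems.LightConeInLawSketch.TimeZero

open scoped BigOperators Topology Classical ENNReal
open Filter Set MeasureTheory
open Literature.MathematicalPhysics.KineticTheory Literature.Analysis.FluidPDE

noncomputable section

/-! ### Bounded-Lipschitz merging (abstract) -/

/-- **Convergence in probability to a constant gives convergence of expectations of bounded
`1`-Lipschitz functionals**, for a sequence of probability spaces: if `P N {δ < dist (X N) L} → 0`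
for every `δ > 0`, `F` is `1`-Lipschitz with `|F| ≤ 1` and each `X N` is measurable, then
`∫ F (X N) dP N → F L`. -/
theorem tendsto_integral_of_tendsto_measure_dist {Ω : ℕ → Type*} [∀ N, MeasurableSpace (Ω N)]
    {E : Type*} [PseudoMetricSpace E] [MeasurableSpace E] [OpensMeasurableSpace E]
    (P : (N : ℕ) → Measure (Ω N)) (hP : ∀ N, IsProbabilityMeasure (P N))
    (X : (N : ℕ) → Ω N → E) (hX : ∀ N, Measurable (X N)) (L : E)
    (F : E → ℝ) (hF : LipschitzWith 1 F) (hFb : ∀ p, |F p| ≤ 1)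
    (h : ∀ δ : ℝ, 0 < δ → Tendsto (fun N => P N {ω | δ < dist (X N ω) L}) atTop (𝓝 0)) :
    Tendsto (fun N => ∫ ω, F (X N ω) ∂P N) atTop (𝓝 (F L)) := by
  rw [Metric.tendsto_atTop]
  intro η hη
  have hδ : 0 < η / 4 := by positivity
  have hev := ENNReal.tendsto_nhds_zero.1 (h (η / 4) hδ) (ENNReal.ofReal (η / 4))
    (ENNReal.ofReal_pos.2 hδ)
  rw [eventually_atTop] at hev
  obtain ⟨N₀, hN₀⟩ := hev
  refine ⟨N₀, fun N hN => ?_⟩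
  haveI := hP N
  set S : Set (Ω N) := {ω | η / 4 < dist (X N ω) L}
  have hPS : (P N).real S ≤ η / 4 := ENNReal.toReal_le_of_le_ofReal hδ.le (hN₀ N hN)
  have hXm := hX N
  have hS : MeasurableSet S :=
    measurableSet_lt measurable_const ((continuous_id.dist continuous_const).measurable.comp hXm)
  have hFX : Measurable fun ω => F (X N ω) := hF.continuous.measurable.comp hXm
  have hFXi : Integrable (fun ω => F (X N ω)) (P N) :=
    Integrable.of_bound hFX.aestronglyMeasurable 1 (ae_of_all _ fun ω => by
      rw [Real.norm_eq_abs]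
      exact hFb _)
  have hpt : ∀ ω, |F (X N ω) - F L| ≤ S.indicator (fun _ => (2 : ℝ)) ω + η / 4 := by
    intro ω
    by_cases hω : η / 4 < dist (X N ω) L
    · have hmem : ω ∈ S := hω
      rw [Set.indicator_of_mem hmem]
      have h1 := hFb (X N ω)
      have h2 := hFb L
      have h3 : |F (X N ω) - F L| ≤ |F (X N ω)| + |F L| := abs_sub _ _
      linarith
    · have hmem : ω ∉ S := hω
      rw [Set.indicator_of_notMem hmem, zero_add]
      push Not at hω
      calc |F (X N ω) - F L| = dist (F (X N ω)) (F L) := (Real.dist_eq _ _).symm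
        _ ≤ dist (X N ω) L := by simpa using hF.dist_le_mul (X N ω) L
        _ ≤ η / 4 := hω
  rw [Real.dist_eq]
  have hint : (∫ ω, F (X N ω) ∂P N) - F L = ∫ ω, (F (X N ω) - F L) ∂P N := by
    rw [integral_sub hFXi (integrable_const _), integral_const, probReal_univ, one_smul]
  have hgi : Integrable (fun ω => S.indicator (fun _ => (2 : ℝ)) ω + η / 4) (P N) :=
    ((integrable_const (2 : ℝ)).indicator hS).add (integrable_const _)
  calc |(∫ ω, F (X N ω) ∂P N) - F L| = |∫ ω, (F (X N ω) - F L) ∂P N| := by rw [hint]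
    _ ≤ ∫ ω, |F (X N ω) - F L| ∂P N := abs_integral_le_integral_abs
    _ ≤ ∫ ω, (S.indicator (fun _ => (2 : ℝ)) ω + η / 4) ∂P N :=
        integral_mono_of_nonneg (ae_of_all _ fun ω => abs_nonneg _) hgi (ae_of_all _ hpt)
    _ = 2 * (P N).real S + η / 4 := by
        rw [integral_add ((integrable_const (2 : ℝ)).indicator hS) (integrable_const _),
          integral_indicator_const _ hS, integral_const, probReal_univ, smul_eq_mul, smul_eq_mul,
          mul_comm, one_mul]
    _ < η := by linarith

/-! ### Measurability of the reduced triple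

(The three field-wise facts `measurable_empiricalDensityField`, `measurable_empiricalMomentumField`,
`measurable_empiricalEnergyField` are reused from
`Theorems/ImplosionDichotomyHydroLimitInBandEquilibrium.lean`.) -/

/-- The reduced triple `(σ³ ρ_N(χ), σ³ • j_N(χ), σ³ e_N(χ))` evaluated along the flow at time `t`
is a measurable function of the initial configuration. -/
theorem measurable_reducedTriple {N : ℕ} {ε : ℝ} (Φ : HardSphereFlow G3 ε N) (σ t : ℝ)
    {χ : T3 → ℝ} (hχ : Continuous χ) :
    Measurable fun z : Config N (Fin 3) T3 =>
      (σ ^ 3 * empiricalDensityField (Φ.flow t z) χ,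
        (σ ^ 3) • empiricalMomentumField (Φ.flow t z) χ,
        σ ^ 3 * empiricalEnergyField (Φ.flow t z) χ) := by
  have hfl : Measurable (Φ.flow t) := Φ.measurable_flow t
  have hd : Measurable fun z : Config N (Fin 3) T3 => empiricalDensityField (Φ.flow t z) χ :=
    (measurable_empiricalDensityField hχ).comp hfl
  have hm : Measurable fun z : Config N (Fin 3) T3 => empiricalMomentumField (Φ.flow t z) χ :=
    (measurable_empiricalMomentumField hχ).comp hfl
  have he : Measurable fun z : Config N (Fin 3) T3 => empiricalEnergyField (Φ.flow t z) χ :=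
    (measurable_empiricalEnergyField hχ).comp hfl
  exact (hd.const_mul _).prodMk ((hm.fun_const_smul _).prodMk (he.const_mul _))

/-! ### Convergence in probability of the reduced triple -/

/-- Under `LLNAt n P Φ ρ U Θ t`, the reduced triple converges in probability to
`(σ³ ∫χρ, σ³ • ∫(χρ)•U, σ³ ∫χE)`: sup distance on the triple, union bound over the three
components, each at level `δ / σ³`. -/
theorem tendsto_measure_dist_reducedTriple {n : ℕ → ℕ} {ε : ℕ → ℝ}
    (P : (N : ℕ) → Measure (Config (n N) (Fin 3) T3))
    (Φ : (N : ℕ) → HardSphereFlow G3 (ε N) (n N)) (ρ Θ : T3 → ℝ) (U : T3 → V3) (t : ℝ)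
    (hL : LLNAt n P Φ ρ U Θ t) {σ : ℝ} (hσ : 0 < σ) {χ : T3 → ℝ} (hχ : Continuous χ)
    (δ : ℝ) (hδ : 0 < δ) :
    Tendsto (fun N => P N {z | δ < dist
        (σ ^ 3 * empiricalDensityField ((Φ N).flow t z) χ,
          (σ ^ 3) • empiricalMomentumField ((Φ N).flow t z) χ,
          σ ^ 3 * empiricalEnergyField ((Φ N).flow t z) χ)
        (σ ^ 3 * ∫ x, χ x * ρ x, (σ ^ 3) • ∫ x, (χ x * ρ x) • U x,
          σ ^ 3 * ∫ x, χ x * totalEnergyDensity (ρ x) (U x) (Θ x))}) atTop (𝓝 0) := by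
  have hσ3 : 0 < σ ^ 3 := pow_pos hσ 3
  obtain ⟨h1, h2, h3⟩ := hL χ hχ (δ / σ ^ 3) (div_pos hδ hσ3)
  have hsum := (h1.add h2).add h3
  simp only [add_zero] at hsum
  refine tendsto_of_tendsto_of_tendsto_of_le_of_le tendsto_const_nhds hsum (fun N => zero_le)
    fun N => ?_
  refine (measure_mono fun z hz => ?_).trans
    ((measure_union_le _ _).trans (add_le_add (measure_union_le _ _) le_rfl))
  simp only [Set.mem_setOf_eq, Set.mem_union] at hz ⊢
  rw [Prod.dist_eq, Prod.dist_eq, lt_max_iff, lt_max_iff] at hz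
  rcases hz with hz | hz | hz
  · refine Or.inl (Or.inl ((div_lt_iff₀' hσ3).2 ?_))
    rwa [Real.dist_eq, ← mul_sub, abs_mul, abs_of_pos hσ3] at hz
  · refine Or.inl (Or.inr ((div_lt_iff₀' hσ3).2 ?_))
    rwa [dist_eq_norm, ← smul_sub, norm_smul, Real.norm_eq_abs, abs_of_pos hσ3] at hz
  · refine Or.inr ((div_lt_iff₀' hσ3).2 ?_)
    rwa [Real.dist_eq, ← mul_sub, abs_mul, abs_of_pos hσ3] at hz

/-- **Expectations of bounded Lipschitz functionals of the reduced triple converge** to the value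
at the deterministic limit, under `LLNAt` and for probability laws. -/
theorem tendsto_integral_reducedTriple {n : ℕ → ℕ} {ε : ℕ → ℝ}
    (P : (N : ℕ) → Measure (Config (n N) (Fin 3) T3)) (hP : ∀ N, IsProbabilityMeasure (P N))
    (Φ : (N : ℕ) → HardSphereFlow G3 (ε N) (n N)) (ρ Θ : T3 → ℝ) (U : T3 → V3) (t : ℝ)
    (hL : LLNAt n P Φ ρ U Θ t) {σ : ℝ} (hσ : 0 < σ) {χ : T3 → ℝ} (hχ : Continuous χ)
    (F : ℝ × V3 × ℝ → ℝ) (hF : LipschitzWith 1 F) (hFb : ∀ p, |F p| ≤ 1) :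
    Tendsto (fun N => ∫ z, F (σ ^ 3 * empiricalDensityField ((Φ N).flow t z) χ,
          (σ ^ 3) • empiricalMomentumField ((Φ N).flow t z) χ,
          σ ^ 3 * empiricalEnergyField ((Φ N).flow t z) χ) ∂(P N)) atTop
      (𝓝 (F (σ ^ 3 * ∫ x, χ x * ρ x, (σ ^ 3) • ∫ x, (χ x * ρ x) • U x,
          σ ^ 3 * ∫ x, χ x * totalEnergyDensity (ρ x) (U x) (Θ x)))) :=
  tendsto_integral_of_tendsto_measure_dist P hP
    (fun N z => (σ ^ 3 * empiricalDensityField ((Φ N).flow t z) χ,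
      (σ ^ 3) • empiricalMomentumField ((Φ N).flow t z) χ,
      σ ^ 3 * empiricalEnergyField ((Φ N).flow t z) χ))
    (fun N => measurable_reducedTriple (Φ N) σ t hχ) _ F hF hFb
    (fun δ hδ => tendsto_measure_dist_reducedTriple P Φ ρ Θ U t hL hσ hχ δ hδ)

/-! ### The stub -/

/-- **STUB `stub_timeZero` (the slice `t = 0` of the two-copy light cone in law).** Two gases whose
time-`0` empirical fields satisfy laws of large numbers towards data agreeing in reduced units on
`B(x₀, R)` have asymptotically equal expectations of bounded `1`-Lipschitz functionals of the
reduced empirical fields tested against a continuous `χ` vanishing off `B(x₀, R)`: both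
expectations converge to `F L` for the common deterministic limit `L`. -/
theorem stub_timeZero :
    ∀ (n₁ n₂ : ℕ → ℕ) (ε₁ ε₂ : ℕ → ℝ) (σ₁ σ₂ : ℝ), 0 < σ₁ → 0 < σ₂ →
    ∀ (Φ₁ : (N : ℕ) → HardSphereFlow G3 (ε₁ N) (n₁ N))
      (Φ₂ : (N : ℕ) → HardSphereFlow G3 (ε₂ N) (n₂ N))
      (P₁ : (N : ℕ) → Measure (Config (n₁ N) (Fin 3) T3))
      (P₂ : (N : ℕ) → Measure (Config (n₂ N) (Fin 3) T3)),
      (∀ N, IsProbabilityMeasure (P₁ N)) → (∀ N, IsProbabilityMeasure (P₂ N)) →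
    ∀ (ρ₁ Θ₁ ρ₂ Θ₂ : T3 → ℝ) (U₁ U₂ : T3 → V3),
      LLNAt n₁ P₁ Φ₁ ρ₁ U₁ Θ₁ 0 → LLNAt n₂ P₂ Φ₂ ρ₂ U₂ Θ₂ 0 →
    ∀ (x₀ : T3) (R : ℝ),
      (∀ x, Torus.euclidDist x x₀ < R →
        ρ₁ x * σ₁ ^ 3 = ρ₂ x * σ₂ ^ 3 ∧ U₁ x = U₂ x ∧ Θ₁ x = Θ₂ x) →
    ∀ χ : T3 → ℝ, Continuous χ → (∀ x, R ≤ Torus.euclidDist x x₀ → χ x = 0) →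
    ∀ F : ℝ × V3 × ℝ → ℝ, LipschitzWith 1 F → (∀ p, |F p| ≤ 1) →
      Tendsto (fun N =>
        (∫ z, F (σ₁ ^ 3 * empiricalDensityField ((Φ₁ N).flow 0 z) χ,
            (σ₁ ^ 3) • empiricalMomentumField ((Φ₁ N).flow 0 z) χ,
            σ₁ ^ 3 * empiricalEnergyField ((Φ₁ N).flow 0 z) χ) ∂(P₁ N)) -
        ∫ z, F (σ₂ ^ 3 * empiricalDensityField ((Φ₂ N).flow 0 z) χ,
            (σ₂ ^ 3) • empiricalMomentumField ((Φ₂ N).flow 0 z) χ,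
            σ₂ ^ 3 * empiricalEnergyField ((Φ₂ N).flow 0 z) χ) ∂(P₂ N)) atTop (𝓝 0) := by
  intro n₁ n₂ ε₁ ε₂ σ₁ σ₂ hσ₁ hσ₂ Φ₁ Φ₂ P₁ P₂ hP₁ hP₂ ρ₁ Θ₁ ρ₂ Θ₂ U₁ U₂ hL₁ hL₂ x₀ R hagree χ hχ
    hsupp F hF hFb
  have hlim₁ := tendsto_integral_reducedTriple P₁ hP₁ Φ₁ ρ₁ Θ₁ U₁ 0 hL₁ hσ₁ hχ F hF hFb
  have hlim₂ := tendsto_integral_reducedTriple P₂ hP₂ Φ₂ ρ₂ Θ₂ U₂ 0 hL₂ hσ₂ hχ F hF hFb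
  -- the pointwise agreement of the reduced integrands
  have hptρ : ∀ x, σ₁ ^ 3 * (χ x * ρ₁ x) = σ₂ ^ 3 * (χ x * ρ₂ x) := by
    intro x
    rcases lt_or_ge (Torus.euclidDist x x₀) R with hx | hx
    · have h := (hagree x hx).1
      calc σ₁ ^ 3 * (χ x * ρ₁ x) = χ x * (ρ₁ x * σ₁ ^ 3) := by ring
        _ = χ x * (ρ₂ x * σ₂ ^ 3) := by rw [h]
        _ = σ₂ ^ 3 * (χ x * ρ₂ x) := by ring
    · simp [hsupp x hx]
  have hptU : ∀ x, (σ₁ ^ 3) • ((χ x * ρ₁ x) • U₁ x) = (σ₂ ^ 3) • ((χ x * ρ₂ x) • U₂ x) := by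
    intro x
    rcases lt_or_ge (Torus.euclidDist x x₀) R with hx | hx
    · obtain ⟨-, hU, -⟩ := hagree x hx
      rw [smul_smul, smul_smul, hptρ x, hU]
    · simp [hsupp x hx]
  have hptE : ∀ x, σ₁ ^ 3 * (χ x * totalEnergyDensity (ρ₁ x) (U₁ x) (Θ₁ x)) =
      σ₂ ^ 3 * (χ x * totalEnergyDensity (ρ₂ x) (U₂ x) (Θ₂ x)) := by
    intro x
    rcases lt_or_ge (Torus.euclidDist x x₀) R with hx | hx
    · obtain ⟨-, hU, hΘ⟩ := hagree x hx
      simp only [totalEnergyDensity]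
      calc σ₁ ^ 3 * (χ x * (ρ₁ x * (‖U₁ x‖ ^ 2 / 2 + 3 / 2 * Θ₁ x)))
          = σ₁ ^ 3 * (χ x * ρ₁ x) * (‖U₁ x‖ ^ 2 / 2 + 3 / 2 * Θ₁ x) := by ring
        _ = σ₂ ^ 3 * (χ x * ρ₂ x) * (‖U₂ x‖ ^ 2 / 2 + 3 / 2 * Θ₂ x) := by rw [hptρ x, hU, hΘ]
        _ = σ₂ ^ 3 * (χ x * (ρ₂ x * (‖U₂ x‖ ^ 2 / 2 + 3 / 2 * Θ₂ x))) := by ring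
    · simp [hsupp x hx]
  -- hence the two deterministic limits coincide
  have hLeq : (σ₁ ^ 3 * ∫ x, χ x * ρ₁ x, (σ₁ ^ 3) • ∫ x, (χ x * ρ₁ x) • U₁ x,
        σ₁ ^ 3 * ∫ x, χ x * totalEnergyDensity (ρ₁ x) (U₁ x) (Θ₁ x)) =
      (σ₂ ^ 3 * ∫ x, χ x * ρ₂ x, (σ₂ ^ 3) • ∫ x, (χ x * ρ₂ x) • U₂ x,
        σ₂ ^ 3 * ∫ x, χ x * totalEnergyDensity (ρ₂ x) (U₂ x) (Θ₂ x)) := by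
    refine Prod.ext ?_ (Prod.ext ?_ ?_)
    · change σ₁ ^ 3 * ∫ x, χ x * ρ₁ x = σ₂ ^ 3 * ∫ x, χ x * ρ₂ x
      rw [← integral_const_mul, ← integral_const_mul]
      exact integral_congr_ae (Eventually.of_forall hptρ)
    · change (σ₁ ^ 3) • ∫ x, (χ x * ρ₁ x) • U₁ x = (σ₂ ^ 3) • ∫ x, (χ x * ρ₂ x) • U₂ x
      rw [← integral_smul, ← integral_smul]
      exact integral_congr_ae (Eventually.of_forall hptU)
    · change σ₁ ^ 3 * ∫ x, χ x * totalEnergyDensity (ρ₁ x) (U₁ x) (Θ₁ x) =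
        σ₂ ^ 3 * ∫ x, χ x * totalEnergyDensity (ρ₂ x) (U₂ x) (Θ₂ x)
      rw [← integral_const_mul, ← integral_const_mul]
      exact integral_congr_ae (Eventually.of_forall hptE)
  rw [hLeq] at hlim₁
  have h := hlim₁.sub hlim₂
  rwa [sub_self] at h

end

end Summit.AtomisticToContinuum.HydrodynamicLimit.Theorems.LightConeInLawSketch.TimeZero
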